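import Summits.BirchSwinnertonDyer.BirchSwinnertonDyer.Theorems.ByReductionTypeAtTwoFineSelmerConjAAtTwoAdditivePotGoodCapitulationCertificate
import Summits.BirchSwinnertonDyer.BirchSwinnertonDyer.Theorems.ByReductionTypeAtTwoFineSelmerConjAAtTwoAdditivePotGoodCapitulationDoorTwoPrimes
import Summits.BirchSwinnertonDyer.BirchSwinnertonDyer.Theorems.ByReductionTypeAtTwoFineSelmerConjAAtTwoAdditivePotGoodFukudaRowStampsF
import HarnessLib

/-!
# Route `ByReductionTypeAtTwo` (rung K4), crux C1″ `FineSelmerConjAAtTwoAdditivePotGood` (item stmt-BirchSwinnertonDyer-22615):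
# CAPITULATION CERTIFICATE for the census row `121440bf1` (cubic `2`-torsion point field of discriminant `-10120`, EVEN class number):
# the displayed hypothesis `e₁ = e₀` of `conjA_two_121440bf1_of_fukudaLayers` DISCHARGED — (A)₂ for `121440bf1` modulo `hLim2` ALONE
# (a `--supports 22615` file; seat `bsd-2adic-k4-w1` GEN 7; consumer of `…CapitulationCertificate` and `…ClassGroupCyclicCriterion`)

HONEST FRAMING (cell `bsd-2adic`, D-0036/D-0054/D-0152): a per-class stamp, conditional on `hLim2` (Lim 2017 Thm. 3.5 at `2`) BY NAME and on
nothing else; the former displayed numeric equality `ord₂ h(ℚ(θ, √2)) = ord₂ h(ℚ(θ))` (census/PARI) is now KERNEL. Closes nothing at the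
`∀`-level; nothing booked; BSD is not proved by any of this.

THE CERTIFICATE (`K = ℚ(θ)`, `θ³ + (-3)θ² + (10)θ + (10) = 0`, `K₁ = K(s)`, `s² = 2`):
* K-SIDE (`zpowers_mk0_eq_top_d10120n`): `Cl(K) = ⟨[𝔮]⟩` for `𝔮 = (41, θ − 8)` by a pair-witness Minkowski sweep (`…ClassGroupCyclicCriterion`),
  hence `h_K = ord [𝔮]` — no class number is computed;
* L-SIDE (`capitulationIdentity_d10120n`): in ANY commutative ring with `g(B) = 0`, `S² = 2, together with the two half-integral generators W₁ = ((B+B²) + (1−B²)S)/2, W₄ = (B+B²)S/2 of 𝓞 K₁ (index 4 over ℤ[θ, S])`, the identity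
  `(y) · (41, B − 8, s + 17) = (41) · (41, B − 8, s − 17)` for the explicit `y` below (six generator memberships, each a
  `linear_combination`; found by lattice reduction in `𝓞 K₁`), so the class of `I = (41, θ − 8, s − 17)` — a prime of `K₁` above `𝔮` — is
  `Gal(K₁/K)`-fixed with `N[I] = [𝔮]` (`…CapitulationCertificate`);
* `classNumberPExp_one_eq_zero_layer_d10120n`: the door with TWO primes above `2` (`2 = 𝔭²𝔮`, `4 ∤ g(0)`, `4 ∤ g(1)`) `classNumberPExp_one_eq_classNumberPExp_zero_of_ambiguous_of_nonNorm_unit` (`…CapitulationDoorTwoPrimes`) with the unit `ε = 17 + 15θ − 9θ²` (`N ε = −1`, `ε ↦ 5 (mod 8)` under `θ ↦ z ≡ 3`: not a norm from `K(√2)`).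

References: [Fukuda1994] Thm. 1 (1); [Lim2017FineSelmer] Thm. 3.5, Lemma 3.2; [Lang1990] Ch. 13 §4 Lemma 4.1; [Gras2003] II.6.2;
[Marcus1977] Ch. 5 Thm. 37; [Cohen1993] §6.5.
-/

set_option autoImplicit false
-- sibling precedent (`…FukudaRowStampsE.lean`): the directory name repeats the summit name
set_option linter.dupNamespace false

noncomputable section

open scoped Classical IntermediateField NumberField Real nonZeroDivisors

namespace Summit.BirchSwinnertonDyer.BirchSwinnertonDyer.Theorems.AddKatoTwo

open WeierstrassCurve Field Polynomial IsDedekindDomain NumberField Literature.NumberTheory.EllipticCurves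
  Literature.NumberTheory.GaloisRepresentations Literature.NumberTheory.IwasawaTheory Literature.NumberTheory.NumberFields
  Summit.BirchSwinnertonDyer.BirchSwinnertonDyer.Theses.ByReductionTypeAtTwo

/-! ## §1 K-side: `Cl(K) = ⟨[𝔮]⟩` -/

section KSide

variable (K : Type) [Field K] [NumberField K]

/-- **`Cl(K) = ⟨[𝔮]⟩`, `𝔮 = (41, θ − 8)`, for every cubic number field whose integers contain a root `θ` of
`X³ + (-3)X² + (10)X + (10)`** (`|d_K| ≤ 10120`, `M_K < 29`): a pair-witness sweep over the primes `ℓ < 29` in the order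
2, 3, 5, 7, 11, 13, 17, 19, 23 — for each root `a` of the cubic mod `ℓ` an element of `(ℓ, θ − a)` of norm `ℓ · m` with `m` supported on
the primes treated before (listed in the proof). Consequently `h_K = ord [𝔮]` (no class number is computed). KERNEL.
[cite: Marcus1977, Ch. 5 Thm. 37 and the class-group computations after Cor. 2] [cite: Cohen1993, §6.5] -/
theorem zpowers_mk0_eq_top_d10120n (h3 : Module.finrank ℚ K = 3) (b : 𝓞 K)
    (hb : b ^ 3 + (-3 : ℤ) * b ^ 2 + (10 : ℤ) * b + (10 : ℤ) = 0)
    (h0 : Ideal.span ({((41 : ℕ) : 𝓞 K), b - ((8 : ℕ) : 𝓞 K)} : Set (𝓞 K)) ∈ (Ideal (𝓞 K))⁰) :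
    Subgroup.zpowers (ClassGroup.mk0 ⟨_, h0⟩) = ⊤ := by
  have hirr := irreducible_cubic_d10120n
  have hd : |NumberField.discr K| ≤ (10120 : ℕ) :=
    le_trans (abs_discr_le_abs_cubic_discr K h3 b hirr hb) (by simp only [Cubic.discr]; norm_num)
  have hM := minkowskiBound_lt_of_sqrt_le K h3 hd (s := 100.60) (B := 29)
    ((Real.sqrt_le_sqrt (by norm_num : ((10120 : ℕ) : ℝ) ≤ (100.60 : ℝ) ^ 2)).trans (Real.sqrt_sq (by norm_num)).le) (by norm_num)
  set H : Subgroup (ClassGroup (𝓞 K)) := Subgroup.zpowers (ClassGroup.mk0 ⟨_, h0⟩) with hH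
  have hq : ClassIn H (Ideal.span ({((41 : ℕ) : 𝓞 K), b - ((8 : ℕ) : 𝓞 K)} : Set (𝓞 K))) := classIn_zpowers_self K _ h0
  have hS0 := forall_prime_above_nil K H
  -- `ℓ = 41`: roots [8], treated primes []
  have h_41 : ∀ P : Ideal (𝓞 K), P.IsPrime → P ≠ ⊥ → ((41 : ℕ) : 𝓞 K) ∈ P → ClassIn H P :=
    classIn_above_of_pairWitnesses K h3 b hirr hb (ℓ := 41) (by norm_num) (S := []) (by decide) hS0 (fun a ha hdvd => by
      interval_cases a <;> norm_num at hdvd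
      · exact Or.inl ⟨by norm_num, hq⟩)
  have hS1 := forall_prime_above_cons K h_41 hS0
  -- `ℓ = 2`: roots [0, 1], treated primes [41]
  have h_2 : ∀ P : Ideal (𝓞 K), P.IsPrime → P ≠ ⊥ → ((2 : ℕ) : 𝓞 K) ∈ P → ClassIn H P :=
    classIn_above_of_pairWitnesses K h3 b hirr hb (ℓ := 2) (by norm_num) (S := [41]) (by decide) hS1 (fun a ha hdvd => by
      interval_cases a <;> norm_num at hdvd
      · exact Or.inr ⟨26, -25, 4, 1, 68921, 3, [41], by norm_num, by norm_num, ⟨_, by rw [Nat.cast_one, one_mul]⟩, by norm_num, by decide, by decide⟩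
      · exact Or.inr ⟨71, -21, 6, 1, 1681, 2, [41], by norm_num, by norm_num, ⟨_, by rw [Nat.cast_one, one_mul]⟩, by norm_num, by decide, by decide⟩)
  have hS2 := forall_prime_above_cons K h_2 hS1
  -- `ℓ = 3`: roots [1], treated primes [2, 41]
  have h_3 : ∀ P : Ideal (𝓞 K), P.IsPrime → P ≠ ⊥ → ((3 : ℕ) : 𝓞 K) ∈ P → ClassIn H P :=
    classIn_above_of_pairWitnesses K h3 b hirr hb (ℓ := 3) (by norm_num) (S := [2, 41]) (by decide) hS2 (fun a ha hdvd => by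
      interval_cases a <;> norm_num at hdvd
      · exact Or.inr ⟨2, 0, 1, 1, 128, 7, [2], by norm_num, by norm_num, ⟨_, by rw [Nat.cast_one, one_mul]⟩, by norm_num, by decide, by decide⟩)
  have hS3 := forall_prime_above_cons K h_3 hS2
  -- `ℓ = 5`: roots [0, 3], treated primes [3, 2, 41]
  have h_5 : ∀ P : Ideal (𝓞 K), P.IsPrime → P ≠ ⊥ → ((5 : ℕ) : 𝓞 K) ∈ P → ClassIn H P :=
    classIn_above_of_pairWitnesses K h3 b hirr hb (ℓ := 5) (by norm_num) (S := [3, 2, 41]) (by decide) hS3 (fun a ha hdvd => by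
      interval_cases a <;> norm_num at hdvd
      · exact Or.inr ⟨0, -1, 0, 1, 2, 1, [2], by norm_num, by norm_num, ⟨_, by rw [Nat.cast_one, one_mul]⟩, by norm_num, by decide, by decide⟩
      · exact Or.inr ⟨-2, -1, 0, 1, 6, 1, [2, 3], by norm_num, by norm_num, ⟨_, by rw [Nat.cast_one, one_mul]⟩, by norm_num, by decide, by decide⟩)
  have hS4 := forall_prime_above_cons K h_5 hS3
  -- `ℓ = 7`: roots [], treated primes [5, 3, 2, 41]
  have h_7 : ∀ P : Ideal (𝓞 K), P.IsPrime → P ≠ ⊥ → ((7 : ℕ) : 𝓞 K) ∈ P → ClassIn H P :=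
    classIn_above_of_pairWitnesses K h3 b hirr hb (ℓ := 7) (by norm_num) (S := [5, 3, 2, 41]) (by decide) hS4 (fun a ha hdvd => by
      interval_cases a <;> norm_num at hdvd)
  have hS5 := forall_prime_above_cons K h_7 hS4
  -- `ℓ = 11`: roots [4, 5], treated primes [7, 5, 3, 2, 41]
  have h_11 : ∀ P : Ideal (𝓞 K), P.IsPrime → P ≠ ⊥ → ((11 : ℕ) : 𝓞 K) ∈ P → ClassIn H P :=
    classIn_above_of_pairWitnesses K h3 b hirr hb (ℓ := 11) (by norm_num) (S := [7, 5, 3, 2, 41]) (by decide) hS5 (fun a ha hdvd => by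
      interval_cases a <;> norm_num at hdvd
      · exact Or.inr ⟨1, 1, -1, 1, 5, 1, [5], by norm_num, by norm_num, ⟨_, by rw [Nat.cast_one, one_mul]⟩, by norm_num, by decide, by decide⟩
      · exact Or.inr ⟨-1, -2, 0, 1, 3, 1, [3], by norm_num, by norm_num, ⟨_, by rw [Nat.cast_one, one_mul]⟩, by norm_num, by decide, by decide⟩)
  have hS6 := forall_prime_above_cons K h_11 hS5
  -- `ℓ = 13`: roots [2], treated primes [11, 7, 5, 3, 2, 41]
  have h_13 : ∀ P : Ideal (𝓞 K), P.IsPrime → P ≠ ⊥ → ((13 : ℕ) : 𝓞 K) ∈ P → ClassIn H P :=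
    classIn_above_of_pairWitnesses K h3 b hirr hb (ℓ := 13) (by norm_num) (S := [11, 7, 5, 3, 2, 41]) (by decide) hS6 (fun a ha hdvd => by
      interval_cases a <;> norm_num at hdvd
      · exact Or.inr ⟨2, -1, 0, 1, 2, 1, [2], by norm_num, by norm_num, ⟨_, by rw [Nat.cast_one, one_mul]⟩, by norm_num, by decide, by decide⟩)
  have hS7 := forall_prime_above_cons K h_13 hS6
  -- `ℓ = 17`: roots [11], treated primes [13, 11, 7, 5, 3, 2, 41]
  have h_17 : ∀ P : Ideal (𝓞 K), P.IsPrime → P ≠ ⊥ → ((17 : ℕ) : 𝓞 K) ∈ P → ClassIn H P :=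
    classIn_above_of_pairWitnesses K h3 b hirr hb (ℓ := 17) (by norm_num) (S := [13, 11, 7, 5, 3, 2, 41]) (by decide) hS7 (fun a ha hdvd => by
      interval_cases a <;> norm_num at hdvd
      · exact Or.inr ⟨-2, 0, 1, 1, 16, 4, [2], by norm_num, by norm_num, ⟨_, by rw [Nat.cast_one, one_mul]⟩, by norm_num, by decide, by decide⟩)
  have hS8 := forall_prime_above_cons K h_17 hS7
  -- `ℓ = 19`: roots [], treated primes [17, 13, 11, 7, 5, 3, 2, 41]
  have h_19 : ∀ P : Ideal (𝓞 K), P.IsPrime → P ≠ ⊥ → ((19 : ℕ) : 𝓞 K) ∈ P → ClassIn H P :=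
    classIn_above_of_pairWitnesses K h3 b hirr hb (ℓ := 19) (by norm_num) (S := [17, 13, 11, 7, 5, 3, 2, 41]) (by decide) hS8 (fun a ha hdvd => by
      interval_cases a <;> norm_num at hdvd)
  have hS9 := forall_prime_above_cons K h_19 hS8
  -- `ℓ = 23`: roots [7, 12], treated primes [19, 17, 13, 11, 7, 5, 3, 2, 41]
  have h_23 : ∀ P : Ideal (𝓞 K), P.IsPrime → P ≠ ⊥ → ((23 : ℕ) : 𝓞 K) ∈ P → ClassIn H P :=
    classIn_above_of_pairWitnesses K h3 b hirr hb (ℓ := 23) (by norm_num) (S := [19, 17, 13, 11, 7, 5, 3, 2, 41]) (by decide) hS9 (fun a ha hdvd => by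
      interval_cases a <;> norm_num at hdvd
      · exact Or.inr ⟨3, 0, -1, 1, 22, 1, [2, 11], by norm_num, by norm_num, ⟨_, by rw [Nat.cast_one, one_mul]⟩, by norm_num, by decide, by decide⟩
      · exact Or.inr ⟨1, -2, 0, 1, 5, 1, [5], by norm_num, by norm_num, ⟨_, by rw [Nat.cast_one, one_mul]⟩, by norm_num, by decide, by decide⟩)
  have hS10 := forall_prime_above_cons K h_23 hS9
  exact subgroup_eq_top_of_forall_prime_lt K h3 hM (forall_prime_lt_of_forall_mem K (S := [23, 19, 17, 13, 11, 7, 5, 3, 2, 41]) (by decide) hS10)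

end KSide

/-! ## §2 L-side: the ideal identity in `𝓞 K₁` -/

/-- **The capitulation identity for `121440bf1`**: in any commutative ring with `B³ + (-3)B² + (10)B + (10) = 0` and `S² = 2, together with the two half-integral generators W₁ = ((B+B²) + (1−B²)S)/2, W₄ = (B+B²)S/2 of 𝓞 K₁ (index 4 over ℤ[θ, S])`,
`(y) · (41, B − 8, s + 17) = (41) · (41, B − 8, s − 17)` for the displayed `y` (coefficients found by LLL in the order
`𝓞 K₁ = ℤ[θ,S] + ℤ W₁ + ℤ W₄ (identities certified after multiplication by 4)` of `K₁ = ℚ(θ, √2)`; each membership is a polynomial identity modulo the two relations). KERNEL.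
[cite: Gras2003, II.6.2 (ambiguous ideal classes)] [cite: Cohen2000, §2.3] -/
theorem capitulationIdentity_d10120n {L : Type} [Field L] [NumberField L] (B S W₁ W₄ : 𝓞 L)
    (hB : B ^ 3 + ((-3 : ℤ) : 𝓞 L) * B ^ 2 + ((10 : ℤ) : 𝓞 L) * B + ((10 : ℤ) : 𝓞 L) = 0) (hS : S ^ 2 = 2)
    (hW₁ : 2 * W₁ = ((1 : ℤ) : 𝓞 L) * S + ((1 : ℤ) : 𝓞 L) * B + ((1 : ℤ) : 𝓞 L) * B ^ 2 + ((-1 : ℤ) : 𝓞 L) * B ^ 2 * S) (hW₄ : 2 * W₄ = ((1 : ℤ) : 𝓞 L) * B * S + ((1 : ℤ) : 𝓞 L) * B ^ 2 * S) :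
    ∃ y : 𝓞 L, (∃ u v w : 𝓞 L, y * ((41 : ℕ) : 𝓞 L) = ((41 : ℕ) : 𝓞 L) * (u * ((41 : ℕ) : 𝓞 L) + v * (B - ((8 : ℕ) : 𝓞 L)) + w * (S - ((17 : ℤ) : 𝓞 L)))) ∧
      (∃ u v w : 𝓞 L, y * (B - ((8 : ℕ) : 𝓞 L)) = ((41 : ℕ) : 𝓞 L) * (u * ((41 : ℕ) : 𝓞 L) + v * (B - ((8 : ℕ) : 𝓞 L)) + w * (S - ((17 : ℤ) : 𝓞 L)))) ∧
      (∃ u v w : 𝓞 L, y * (S + ((17 : ℤ) : 𝓞 L)) = ((41 : ℕ) : 𝓞 L) * (u * ((41 : ℕ) : 𝓞 L) + v * (B - ((8 : ℕ) : 𝓞 L)) + w * (S - ((17 : ℤ) : 𝓞 L)))) ∧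
      (∃ u v w : 𝓞 L, ((41 : ℕ) : 𝓞 L) * ((41 : ℕ) : 𝓞 L) = y * (u * ((41 : ℕ) : 𝓞 L) + v * (B - ((8 : ℕ) : 𝓞 L)) + w * (S + ((17 : ℤ) : 𝓞 L)))) ∧
      (∃ u v w : 𝓞 L, ((41 : ℕ) : 𝓞 L) * (B - ((8 : ℕ) : 𝓞 L)) = y * (u * ((41 : ℕ) : 𝓞 L) + v * (B - ((8 : ℕ) : 𝓞 L)) + w * (S + ((17 : ℤ) : 𝓞 L)))) ∧
      (∃ u v w : 𝓞 L, ((41 : ℕ) : 𝓞 L) * (S - ((17 : ℤ) : 𝓞 L)) = y * (u * ((41 : ℕ) : 𝓞 L) + v * (B - ((8 : ℕ) : 𝓞 L)) + w * (S + ((17 : ℤ) : 𝓞 L)))) := by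
  have h4 : (4 : 𝓞 L) ≠ 0 := by norm_num
  have hW₁₁ : (2 * W₁) * (2 * W₁) = (((1 : ℤ) : 𝓞 L) * S + ((1 : ℤ) : 𝓞 L) * B + ((1 : ℤ) : 𝓞 L) * B ^ 2 + ((-1 : ℤ) : 𝓞 L) * B ^ 2 * S) * (((1 : ℤ) : 𝓞 L) * S + ((1 : ℤ) : 𝓞 L) * B + ((1 : ℤ) : 𝓞 L) * B ^ 2 + ((-1 : ℤ) : 𝓞 L) * B ^ 2 * S) := by rw [hW₁]
  have hW₁₄ : (2 * W₁) * (2 * W₄) = (((1 : ℤ) : 𝓞 L) * S + ((1 : ℤ) : 𝓞 L) * B + ((1 : ℤ) : 𝓞 L) * B ^ 2 + ((-1 : ℤ) : 𝓞 L) * B ^ 2 * S) * (((1 : ℤ) : 𝓞 L) * B * S + ((1 : ℤ) : 𝓞 L) * B ^ 2 * S) := by rw [hW₁, hW₄]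
  have hW₄₄ : (2 * W₄) * (2 * W₄) = (((1 : ℤ) : 𝓞 L) * B * S + ((1 : ℤ) : 𝓞 L) * B ^ 2 * S) * (((1 : ℤ) : 𝓞 L) * B * S + ((1 : ℤ) : 𝓞 L) * B ^ 2 * S) := by rw [hW₄]
  refine ⟨((52 : ℤ) : 𝓞 L) + ((53 : ℤ) : 𝓞 L) * S + ((27 : ℤ) : 𝓞 L) * B ^ 2 + ((-7 : ℤ) : 𝓞 L) * B ^ 2 * S + (((-31 : ℤ) : 𝓞 L)) * W₄ + (((-47 : ℤ) : 𝓞 L)) * W₁, ?_, ?_, ?_, ?_, ?_, ?_⟩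
  · exact ⟨((1 : ℤ) : 𝓞 L) + ((2 : ℤ) : 𝓞 L) * B ^ 2 * S + (((-2 : ℤ) : 𝓞 L)) * W₄ + (((-1 : ℤ) : 𝓞 L)) * W₁, (0 : 𝓞 L), ((-1 : ℤ) : 𝓞 L) + ((-3 : ℤ) : 𝓞 L) * S + ((-1 : ℤ) : 𝓞 L) * B ^ 2 + ((5 : ℤ) : 𝓞 L) * B ^ 2 * S + (((-3 : ℤ) : 𝓞 L)) * W₄, mul_left_cancel₀ h4 (by push_cast; linear_combination (((-492 : ℤ) : 𝓞 L)) * hW₁ + (((246 : ℤ) : 𝓞 L) * S) * hW₄ + (((492 : ℤ) : 𝓞 L) + ((246 : ℤ) : 𝓞 L) * B + ((-574 : ℤ) : 𝓞 L) * B ^ 2) * hS)⟩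
  · exact ⟨((-1 : ℤ) : 𝓞 L) * S + ((1 : ℤ) : 𝓞 L) * B ^ 2 * S + (((1 : ℤ) : 𝓞 L)) * W₁, ((1 : ℤ) : 𝓞 L) + ((1 : ℤ) : 𝓞 L) * S + ((-1 : ℤ) : 𝓞 L) * B ^ 2 + (((1 : ℤ) : 𝓞 L)) * W₄ + (((2 : ℤ) : 𝓞 L)) * W₁, ((-2 : ℤ) : 𝓞 L) * S + ((1 : ℤ) : 𝓞 L) * B ^ 2 + ((2 : ℤ) : 𝓞 L) * B ^ 2 * S + (((1 : ℤ) : 𝓞 L)) * W₁, mul_left_cancel₀ h4 (by push_cast; linear_combination (((96 : ℤ) : 𝓞 L) + ((-82 : ℤ) : 𝓞 L) * S + ((-258 : ℤ) : 𝓞 L) * B) * hW₁ + (((1152 : ℤ) : 𝓞 L) + ((-144 : ℤ) : 𝓞 L) * B) * hW₄ + (((14 : ℤ) : 𝓞 L) + ((86 : ℤ) : 𝓞 L) * S) * hB + (((246 : ℤ) : 𝓞 L) + ((-246 : ℤ) : 𝓞 L) * B ^ 2) * hS)⟩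
  · exact ⟨((1 : ℤ) : 𝓞 L) * S + ((-1 : ℤ) : 𝓞 L) * B ^ 2 * S + (((2 : ℤ) : 𝓞 L)) * W₄ + (((-1 : ℤ) : 𝓞 L)) * W₁, ((-1 : ℤ) : 𝓞 L) * B ^ 2 + ((3 : ℤ) : 𝓞 L) * B ^ 2 * S + (((2 : ℤ) : 𝓞 L)) * W₄, ((-1 : ℤ) : 𝓞 L) + ((-2 : ℤ) : 𝓞 L) * S + ((-1 : ℤ) : 𝓞 L) * B ^ 2, mul_left_cancel₀ h4 (by push_cast; linear_combination (((1764 : ℤ) : 𝓞 L) + ((-94 : ℤ) : 𝓞 L) * S) * hW₁ + (((-6466 : ℤ) : 𝓞 L) + ((-62 : ℤ) : 𝓞 L) * S + ((-164 : ℤ) : 𝓞 L) * B) * hW₄ + (((164 : ℤ) : 𝓞 L) + ((-656 : ℤ) : 𝓞 L) * S) * hB + (((446 : ℤ) : 𝓞 L) + ((-62 : ℤ) : 𝓞 L) * B + ((4 : ℤ) : 𝓞 L) * B ^ 2) * hS)⟩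
  · exact ⟨((-1 : ℤ) : 𝓞 L) * S + ((1 : ℤ) : 𝓞 L) * B ^ 2 * S, (0 : 𝓞 L), ((3 : ℤ) : 𝓞 L) + ((2 : ℤ) : 𝓞 L) * S + ((2 : ℤ) : 𝓞 L) * B ^ 2 + ((-5 : ℤ) : 𝓞 L) * B ^ 2 * S + (((2 : ℤ) : 𝓞 L)) * W₄ + (((-3 : ℤ) : 𝓞 L)) * W₁, mul_left_cancel₀ h4 (by push_cast; linear_combination (((10098 : ℤ) : 𝓞 L) + ((5342 : ℤ) : 𝓞 L) * S + ((506 : ℤ) : 𝓞 L) * S ^ 2 + ((5950 : ℤ) : 𝓞 L) * B ^ 2 + ((-4500 : ℤ) : 𝓞 L) * B ^ 2 * S + ((-512 : ℤ) : 𝓞 L) * B ^ 2 * S ^ 2) * hW₁ + (((-374 : ℤ) : 𝓞 L) + ((-4060 : ℤ) : 𝓞 L) * S + ((-88 : ℤ) : 𝓞 L) * S ^ 2 + ((272 : ℤ) : 𝓞 L) * B ^ 2 + ((-2236 : ℤ) : 𝓞 L) * B ^ 2 * S + ((-282 : ℤ) : 𝓞 L) * B ^ 2 * S ^ 2) * hW₄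 + (((-2397 : ℤ) : 𝓞 L) + ((-141 : ℤ) : 𝓞 L) * S) * hW₁₁ + (((17 : ℤ) : 𝓞 L) + ((1 : ℤ) : 𝓞 L) * S) * hW₁₄ + (((1054 : ℤ) : 𝓞 L) + ((62 : ℤ) : 𝓞 L) * S) * hW₄₄ + (((287 : ℤ) : 𝓞 L) + ((-41 : ℤ) : 𝓞 L) * B) * hB + (((3377 : ℤ) : 𝓞 L) + ((-59 : ℤ) : 𝓞 L) * S + ((-3819 : ℤ) : 𝓞 L) * B + ((-87 : ℤ) : 𝓞 L) * B * S + ((1804 : ℤ) : 𝓞 L) * B ^ 2 + ((355 : ℤ) : 𝓞 L) * B ^ 2 * S + ((-373 : ℤ) : 𝓞 L) * B ^ 3 + ((-159 : ℤ) : 𝓞 L) * B ^ 3 * S + ((39 : ℤ) : 𝓞 L) * B ^ 4 + ((10 : ℤ) : 𝓞 L) * B ^ 4 * S) * hS)⟩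
  · exact ⟨(((1 : ℤ) : 𝓞 L)) * W₁, ((1 : ℤ) : 𝓞 L) + ((-3 : ℤ) : 𝓞 L) * S + ((-1 : ℤ) : 𝓞 L) * B ^ 2 + ((2 : ℤ) : 𝓞 L) * B ^ 2 * S + (((-1 : ℤ) : 𝓞 L)) * W₄ + (((2 : ℤ) : 𝓞 L)) * W₁, ((-1 : ℤ) : 𝓞 L) * S + ((-1 : ℤ) : 𝓞 L) * B ^ 2 + ((1 : ℤ) : 𝓞 L) * B ^ 2 * S + (((-1 : ℤ) : 𝓞 L)) * W₁, mul_left_cancel₀ h4 (by push_cast; linear_combination (((-1584 : ℤ) : 𝓞 L) + ((-86 : ℤ) : 𝓞 L) * S + ((12 : ℤ) : 𝓞 L) * S ^ 2 + ((-114 : ℤ) : 𝓞 L) * B + ((-494 : ℤ) : 𝓞 L) * B * S + ((-1278 : ℤ) : 𝓞 L) * B ^ 2 + ((166 : ℤ) : 𝓞 L) * B ^ 2 * S + ((80 : ℤ) : 𝓞 L) * B ^ 2 * S ^ 2 + ((-202 : ℤ) : 𝓞 L) * B ^ 3 + ((216 : ℤ) : 𝓞 L) * B ^ 3 * S) * hW₁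 + (((-1328 : ℤ) : 𝓞 L) + ((-414 : ℤ) : 𝓞 L) * S + ((-62 : ℤ) : 𝓞 L) * S ^ 2 + ((166 : ℤ) : 𝓞 L) * B + ((-80 : ℤ) : 𝓞 L) * B * S + ((-990 : ℤ) : 𝓞 L) * B ^ 2 + ((112 : ℤ) : 𝓞 L) * B ^ 2 * S + ((62 : ℤ) : 𝓞 L) * B ^ 2 * S ^ 2 + ((-8 : ℤ) : 𝓞 L) * B ^ 3 + ((110 : ℤ) : 𝓞 L) * B ^ 3 * S) * hW₄ + (((376 : ℤ) : 𝓞 L) + ((-47 : ℤ) : 𝓞 L) * S + ((94 : ℤ) : 𝓞 L) * B) * hW₁₁ + (((624 : ℤ) : 𝓞 L) + ((-31 : ℤ) : 𝓞 L) * S + ((15 : ℤ) : 𝓞 L) * B) * hW₁₄ + (((248 : ℤ) : 𝓞 L) + ((-31 : ℤ) : 𝓞 L) * B) * hW₄₄ + (((-162 : ℤ) : 𝓞 L) + ((-99 : ℤ) : 𝓞 L) * S + ((72 : ℤ) : 𝓞 L) * B + ((44 : ℤ) : 𝓞 L) * B * S + ((-4 : ℤ) : 𝓞 L) * B ^ 2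 + ((-7 : ℤ) : 𝓞 L) * B ^ 2 * S) * hB + (((-986 : ℤ) : 𝓞 L) + ((177 : ℤ) : 𝓞 L) * S + ((364 : ℤ) : 𝓞 L) * B + ((-93 : ℤ) : 𝓞 L) * B * S + ((-124 : ℤ) : 𝓞 L) * B ^ 2 + ((-171 : ℤ) : 𝓞 L) * B ^ 2 * S + ((14 : ℤ) : 𝓞 L) * B ^ 3 + ((93 : ℤ) : 𝓞 L) * B ^ 3 * S + ((14 : ℤ) : 𝓞 L) * B ^ 4 + ((-6 : ℤ) : 𝓞 L) * B ^ 4 * S + ((-2 : ℤ) : 𝓞 L) * B ^ 5) * hS)⟩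
  · exact ⟨((-2 : ℤ) : 𝓞 L) + ((-1 : ℤ) : 𝓞 L) * B ^ 2 * S + (((-1 : ℤ) : 𝓞 L)) * W₁, ((-1 : ℤ) : 𝓞 L) + ((-3 : ℤ) : 𝓞 L) * S + ((-3 : ℤ) : 𝓞 L) * B ^ 2 + ((3 : ℤ) : 𝓞 L) * B ^ 2 * S + (((-1 : ℤ) : 𝓞 L)) * W₄, ((1 : ℤ) : 𝓞 L) + ((2 : ℤ) : 𝓞 L) * S + ((1 : ℤ) : 𝓞 L) * B ^ 2 * S + (((2 : ℤ) : 𝓞 L)) * W₄, mul_left_cancel₀ h4 (by push_cast; linear_combination (((-1094 : ℤ) : 𝓞 L) + ((9892 : ℤ) : 𝓞 L) * S + ((188 : ℤ) : 𝓞 L) * S ^ 2 + ((-94 : ℤ) : 𝓞 L) * B + ((-282 : ℤ) : 𝓞 L) * B * S + ((4470 : ℤ) : 𝓞 L) * B ^ 2 + ((-5086 : ℤ) : 𝓞 L) * B ^ 2 * S + ((94 : ℤ) : 𝓞 L) * B ^ 2 * S ^ 2 + ((-282 : ℤ) : 𝓞 L) * B ^ 3 + ((282 : ℤ) : 𝓞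 L) * B ^ 3 * S) * hW₁ + (((-7902 : ℤ) : 𝓞 L) + ((-1002 : ℤ) : 𝓞 L) * S + ((-88 : ℤ) : 𝓞 L) * S ^ 2 + ((42 : ℤ) : 𝓞 L) * B + ((-80 : ℤ) : 𝓞 L) * B * S + ((-780 : ℤ) : 𝓞 L) * B ^ 2 + ((-2496 : ℤ) : 𝓞 L) * B ^ 2 * S + ((90 : ℤ) : 𝓞 L) * B ^ 2 * S ^ 2 + ((-132 : ℤ) : 𝓞 L) * B ^ 3 + ((172 : ℤ) : 𝓞 L) * B ^ 3 * S) * hW₄ + (((-1927 : ℤ) : 𝓞 L)) * hW₁₁ + (((703 : ℤ) : 𝓞 L) + ((94 : ℤ) : 𝓞 L) * S + ((-47 : ℤ) : 𝓞 L) * B) * hW₁₄ + (((1302 : ℤ) : 𝓞 L) + ((62 : ℤ) : 𝓞 L) * S + ((-31 : ℤ) : 𝓞 L) * B) * hW₄₄ + (((-85 : ℤ) : 𝓞 L) + ((-159 : ℤ) : 𝓞 L) * S + ((45 : ℤ) : 𝓞 L) * B + ((48 : ℤ) : 𝓞 L) * B * S + ((22 : ℤ) : 𝓞 L) * B ^ 2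 + ((-23 : ℤ) : 𝓞 L) * B ^ 2 * S) * hB + (((-4959 : ℤ) : 𝓞 L) + ((-236 : ℤ) : 𝓞 L) * S + ((243 : ℤ) : 𝓞 L) * B + ((6 : ℤ) : 𝓞 L) * B * S + ((1438 : ℤ) : 𝓞 L) * B ^ 2 + ((-182 : ℤ) : 𝓞 L) * B ^ 2 * S + ((-627 : ℤ) : 𝓞 L) * B ^ 3 + ((120 : ℤ) : 𝓞 L) * B ^ 3 * S + ((155 : ℤ) : 𝓞 L) * B ^ 4 + ((-8 : ℤ) : 𝓞 L) * B ^ 4 * S + ((-10 : ℤ) : 𝓞 L) * B ^ 5) * hS)⟩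

/-! ## §3 The displayed hypothesis `e₁ = e₀` discharged, and the census stamp -/

/-- **`e₁ = e₀` along the cyclotomic `ℤ₂`-tower of `ℚ(θ)`**, `θ` any root of `X³ + (-3)X² + (10)X + (10)` — the displayed hypothesis
`h01` of `conjA_two_121440bf1_of_fukudaLayers`, now KERNEL: §1 (`h_K = ord [𝔮]`), §2 (the ambiguous class above `𝔮`), and
the door with TWO primes above `2` (`2 = 𝔭²𝔮`, `4 ∤ g(0)`, `4 ∤ g(1)`) `classNumberPExp_one_eq_classNumberPExp_zero_of_ambiguous_of_nonNorm_unit` (`…CapitulationDoorTwoPrimes`) with the unit `ε = 17 + 15θ − 9θ²` (`N ε = −1`, `ε ↦ 5 (mod 8)` under `θ ↦ z ≡ 3`: not a norm from `K(√2)`).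
[cite: Lang1990, Ch. 13 §4, Lemma 4.1] [cite: Gras2003, II.6.2.3] [cite: Fukuda1994, Thm. 1 (1), p. 264] -/
theorem classNumberPExp_one_eq_zero_layer_d10120n {θ : AlgebraicClosure ℚ}
    (hθ : aeval θ (Cubic.toPoly ⟨1, ((-3 : ℤ) : ℚ), ((10 : ℤ) : ℚ), ((10 : ℤ) : ℚ)⟩) = 0) :
    haveI : FiniteDimensional ℚ (IntermediateField.adjoin ℚ {θ}) :=
      IntermediateField.adjoin.finiteDimensional ((AlgebraicClosure.isAlgebraic ℚ).isAlgebraic θ).isIntegral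
    haveI : NumberField (IntermediateField.adjoin ℚ {θ}) := NumberField.mk
    ∀ κL : ZpExtension (IntermediateField.adjoin ℚ {θ}) 2, κL.IsCyclotomic → classNumberPExp κL 1 = classNumberPExp κL 0 := by
  haveI : FiniteDimensional ℚ (IntermediateField.adjoin ℚ {θ}) :=
    IntermediateField.adjoin.finiteDimensional ((AlgebraicClosure.isAlgebraic ℚ).isAlgebraic θ).isIntegral
  haveI : NumberField (IntermediateField.adjoin ℚ {θ}) := NumberField.mk
  intro κL hκL
  have hirr := irreducible_cubic_d10120n
  have h3 := finrank_adjoin_eq_three_of_irreducible hirr hθ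
  obtain ⟨b, -, hb⟩ := exists_ringOfIntegers_cubic_root (p := -3) (q := 10) (r := 10) hθ
  have hs2 := ncard_primes_above_two_le_two _ h3 b hirr hb ⟨0, by norm_num⟩ ⟨0, by norm_num⟩
  have hθ' : θ ^ 3 + (-3 : AlgebraicClosure ℚ) * θ ^ 2 + (10 : AlgebraicClosure ℚ) * θ + (10 : AlgebraicClosure ℚ) = 0 := by
    have := hθ
    simp only [Cubic.toPoly, map_one, one_mul, aeval_add, aeval_mul, aeval_C, aeval_X_pow, aeval_X,
      eq_ratCast, Rat.cast_intCast] at this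
    push_cast at this
    linear_combination this
  have he : aeval (algebraMap ℚ (AlgebraicClosure ℚ) (((17 : ℤ) : ℚ) / ((1 : ℤ) : ℚ)) +
      algebraMap ℚ (AlgebraicClosure ℚ) (((15 : ℤ) : ℚ) / ((1 : ℤ) : ℚ)) * θ +
      algebraMap ℚ (AlgebraicClosure ℚ) (((-9 : ℤ) : ℚ) / ((1 : ℤ) : ℚ)) * θ ^ 2)
      (Cubic.toPoly ⟨1, ((-195 : ℤ) : ℚ), ((12873 : ℤ) : ℚ), ((1 : ℤ) : ℚ)⟩) = 0 := by
    simp only [Cubic.toPoly, map_one, one_mul, aeval_add, aeval_mul, aeval_C, aeval_X_pow, aeval_X, eq_ratCast,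
      Rat.cast_intCast, Rat.cast_div]
    push_cast
    linear_combination ((16740 : AlgebraicClosure ℚ) + (-6075 : AlgebraicClosure ℚ) * θ + (1458 : AlgebraicClosure ℚ) * θ ^ 2 + (-729 : AlgebraicClosure ℚ) * θ ^ 3) * hθ'
  obtain ⟨ε, hεu, hnn⟩ := exists_nonNorm_unit_of_padicCert hirr hθ (17) (15) (-9) (1) (-195) (12873) (1) (by norm_num) he
    (3) (1) (by norm_num) (by norm_num) (by decide) (by decide)
  have h0 : Ideal.span ({((41 : ℕ) : 𝓞 (IntermediateField.adjoin ℚ {θ})), b - ((8 : ℕ) : 𝓞 (IntermediateField.adjoin ℚ {θ}))} : Set _) ∈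
      (Ideal (𝓞 (IntermediateField.adjoin ℚ {θ})))⁰ := by
    refine mem_nonZeroDivisors_of_ne_zero fun h => ?_
    have hmem : ((41 : ℕ) : 𝓞 (IntermediateField.adjoin ℚ {θ})) ∈
        Ideal.span ({((41 : ℕ) : 𝓞 (IntermediateField.adjoin ℚ {θ})), b - ((8 : ℕ) : 𝓞 (IntermediateField.adjoin ℚ {θ}))} : Set _) :=
      Ideal.subset_span (by simp)
    rw [h] at hmem
    exact absurd (Nat.cast_eq_zero.mp ((Submodule.mem_bot _).mp hmem)) (by norm_num)
  refine classNumberPExp_one_eq_classNumberPExp_zero_of_ambiguous_of_nonNorm_unit (by rw [h3]; decide) κL hκL hs2 hεu hnn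
    (exists_ambiguous_of_certificate (by rw [h3]; decide) κL hκL (n := 41) (by norm_num) h0
      (zpowers_mk0_eq_top_d10120n _ h3 b hb h0) (t := 17) (w := 7) (u := -1) (v := 6) (a := -6) (c := 5)
      (by norm_num) (by norm_num) (by norm_num) ?_)
  intro L _ _ _ s hs
  have hB : (algebraMap _ (𝓞 L) b) ^ 3 + ((-3 : ℤ) : 𝓞 L) * (algebraMap _ (𝓞 L) b) ^ 2 +
      ((10 : ℤ) : 𝓞 L) * (algebraMap _ (𝓞 L) b) + ((10 : ℤ) : 𝓞 L) = 0 := by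
    simpa only [map_add, map_mul, map_pow, map_intCast, map_zero] using
      congrArg (algebraMap (𝓞 (IntermediateField.adjoin ℚ {θ})) (𝓞 L)) hb
  obtain ⟨W₁, hW₁⟩ := exists_two_mul_eq_of_quadratic (((1 : ℤ) : 𝓞 L) * s + ((1 : ℤ) : 𝓞 L) * (algebraMap _ (𝓞 L) b) + ((1 : ℤ) : 𝓞 L) * (algebraMap _ (𝓞 L) b) ^ 2 + ((-1 : ℤ) : 𝓞 L) * (algebraMap _ (𝓞 L) b) ^ 2 * s) (((-1 : ℤ) : 𝓞 L) * (algebraMap _ (𝓞 L) b) + ((-1 : ℤ) : 𝓞 L) * (algebraMap _ (𝓞 L) b) ^ 2) (((2 : ℤ) : 𝓞 L) + ((5 : ℤ) : 𝓞 L) * (algebraMap _ (𝓞 L) b) + ((3 : ℤ) : 𝓞 L) * (algebraMap _ (𝓞 L) b) ^ 2)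
    (by push_cast; linear_combination (((1 : ℤ) : 𝓞 L) + ((1 : ℤ) : 𝓞 L) * (algebraMap _ (𝓞 L) b)) * hB + (((1 : ℤ) : 𝓞 L) + ((-2 : ℤ) : 𝓞 L) * (algebraMap _ (𝓞 L) b) ^ 2 + ((1 : ℤ) : 𝓞 L) * (algebraMap _ (𝓞 L) b) ^ 4) * hs)
  obtain ⟨W₄, hW₄⟩ := exists_two_mul_eq_of_quadratic (((1 : ℤ) : 𝓞 L) * (algebraMap _ (𝓞 L) b) * s + ((1 : ℤ) : 𝓞 L) * (algebraMap _ (𝓞 L) b) ^ 2 * s) ((0 : 𝓞 L)) (((25 : ℤ) : 𝓞 L) + ((30 : ℤ) : 𝓞 L) * (algebraMap _ (𝓞 L) b) + ((-3 : ℤ) : 𝓞 L) * (algebraMap _ (𝓞 L) b) ^ 2)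
    (by push_cast; linear_combination (((10 : ℤ) : 𝓞 L) + ((2 : ℤ) : 𝓞 L) * (algebraMap _ (𝓞 L) b)) * hB + (((1 : ℤ) : 𝓞 L) * (algebraMap _ (𝓞 L) b) ^ 2 + ((2 : ℤ) : 𝓞 L) * (algebraMap _ (𝓞 L) b) ^ 3 + ((1 : ℤ) : 𝓞 L) * (algebraMap _ (𝓞 L) b) ^ 4) * hs)
  obtain ⟨y, h1, h2, h3, h4, h5, h6⟩ := capitulationIdentity_d10120n _ s W₁ W₄ hB hs hW₁ hW₄
  rw [map_sub, map_natCast]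
  exact ⟨y, ((41 : ℕ) : 𝓞 L), Nat.cast_ne_zero.mpr (by norm_num), h1, h2, h3, h4, h5, h6⟩

/-- **(A)₂ FOR `121440bf1` MODULO `hLim2` ALONE — no displayed datum left.** The Fukuda-row stamp `conjA_two_121440bf1_of_fukudaLayers` (k4-w1 GEN 5)
with its displayed hypothesis `e₁ = e₀` supplied by `classNumberPExp_one_eq_zero_layer_d10120n` (KERNEL: class-group certificate for `ℚ(θ)`,
capitulation certificate in `ℚ(θ, √2)`, Chevalley's ambiguous class number formula, Fukuda 1994 Thm. 1 (1)). Conditional on `hLim2`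
(Lim 2017 Thm. 3.5 at `2`) BY NAME; BSD is not proved by this. [cite: Lim2017FineSelmer, §3 Thm. 3.5 and Lemma 3.2]
[cite: Fukuda1994, Thm. 1 (1), p. 264] [cite: Lang1990, Ch. 13 §4, Lemma 4.1] -/
theorem conjA_two_121440bf1
    (hLim2 : Lim2017.thm35_at_two_fineSelmerDual_moduleFinite_of_classicalMuVanishes_of_le_divisionField_four)
    {θ : AlgebraicClosure ℚ} (hθ : aeval θ (Cubic.toPoly ⟨1, ((-3 : ℤ) : ℚ), ((10 : ℤ) : ℚ), ((10 : ℤ) : ℚ)⟩) = 0)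
    (κ : ZpExtension ℚ 2) (hκ : κ.IsCyclotomic) :
    haveI := isElliptic_121440bf1'
    ∃ (γ : absoluteGaloisGroup ℚ) (D : (⟨0, ((-1 : ℤ) : ℚ), 0, ((-3251092416 : ℤ) : ℚ), ((-71348605585884 : ℤ) : ℚ)⟩ : WeierstrassCurve ℚ).FineSelmerDualData κ γ),
      Module.Finite ℤ_[2] (RestrictScalars ℤ_[2] (IwasawaAlgebra 2) D.X) :=
  conjA_two_121440bf1_of_fukudaLayers hLim2 hθ (classNumberPExp_one_eq_zero_layer_d10120n hθ) κ hκ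

end Summit.BirchSwinnertonDyer.BirchSwinnertonDyer.Theorems.AddKatoTwo

end
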